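import Mathlib
import HarnessLib

/-!
# Line `Sketch` (coupling response), Z1-explicit E2: `gevreyPairCutoffFamily`

Stub file for crux `stmt-QuantumFields-16154` (`HypercubicLimit`), line `Sketch`: from a Gevrey-2 step
function `g : ℝ → ℝ` (smooth, values in `[0, 1]`, `= 0` on `(-∞, 0]`, `= 1` on `[1, ∞)`, with
`‖g^{(l)}‖ ≤ Cg ^ (l + 1) (l!)²`) we build, for every number of points `n` and every scale `κ ≥ 1`, a smooth
cutoff `ψ` on `n`-point configurations `x : Fin n → ℝ⁴` which is `1` where all pairwise distances are
`≥ 2/κ`, `0` where some pairwise distance is `≤ 1/κ`, and whose derivatives obey the explicit Gevrey-3 bound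
`‖D^l ψ‖ ≤ (A (n+1)² κ)^l (l!)³` with `A = 8 Cg²` depending on `g` only.

Construction: `ψ = ∏_{i ≠ j} g (q_{ij})` with `q_{ij}(x) = κ² ‖xᵢ - xⱼ‖² - 1`; the single factors are
bounded through `norm_iteratedFDeriv_comp_le` (inner map quadratic, so only its first two derivatives are
nonzero, and at points where the factor is not locally constant they are `≤ (8κ)^i`), the product through the
Leibniz bound `norm_iteratedFDeriv_mul_le` and the elementary estimate `choose l i · (i!)³ ((l-i)!)³ ≤ (l!)³`.
-/

noncomputable section

open scoped ContDiff BigOperators Nat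
open Filter Topology

namespace Summit.QuantumFields.YangMills.Cruxes.HypercubicLimit.CouplingResponse

/-- Leibniz step for Gevrey-3 bounds: if `u i ≤ a^i (i!)³` and `v i ≤ b^i (i!)³` then the binomial
convolution `∑ (l choose i) u_i v_{l-i}` is at most `(a + b)^l (l!)³` (using `i! (l-i)! ≤ l!`). -/
theorem sum_choose_mul_gevrey_le {a b : ℝ} (ha : 0 ≤ a) (hb : 0 ≤ b) {u v : ℕ → ℝ}
    (hv0 : ∀ i, 0 ≤ v i) (hu : ∀ i, u i ≤ a ^ i * ((i ! : ℕ) : ℝ) ^ 3)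
    (hv : ∀ i, v i ≤ b ^ i * ((i ! : ℕ) : ℝ) ^ 3) (l : ℕ) :
    ∑ i ∈ Finset.range (l + 1), (l.choose i : ℝ) * u i * v (l - i) ≤
      (a + b) ^ l * ((l ! : ℕ) : ℝ) ^ 3 := by
  rw [add_pow, Finset.sum_mul]
  refine Finset.sum_le_sum fun i hi => ?_
  have hil : i ≤ l := Nat.lt_succ_iff.mp (Finset.mem_range.mp hi)
  have hf : ((i ! : ℕ) : ℝ) * (((l - i) ! : ℕ) : ℝ) ≤ ((l ! : ℕ) : ℝ) := by
    exact_mod_cast Nat.le_of_dvd (Nat.factorial_pos l)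
      (Nat.factorial_mul_factorial_dvd_factorial hil)
  have hv0' := hv0 (l - i)
  calc (l.choose i : ℝ) * u i * v (l - i)
      ≤ (l.choose i : ℝ) * (a ^ i * ((i ! : ℕ) : ℝ) ^ 3) *
          (b ^ (l - i) * (((l - i) ! : ℕ) : ℝ) ^ 3) := by
        gcongr
        · exact hu i
        · exact hv (l - i)
    _ = a ^ i * b ^ (l - i) * (l.choose i : ℝ) * (((i ! : ℕ) : ℝ) * (((l - i) ! : ℕ) : ℝ)) ^ 3 := by
        ring
    _ ≤ a ^ i * b ^ (l - i) * (l.choose i : ℝ) * ((l ! : ℕ) : ℝ) ^ 3 := by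
        gcongr

/-- Derivative bounds for a shifted quadratic form `y ↦ B (L y) (L y) + d` (`B` bilinear of norm `≤ 1`,
`L` continuous linear): its derivatives of order `≥ 3` vanish, and the first two are controlled by
`2 ‖L‖ ‖L x‖` and `2 ‖L‖²`; hence `‖D^i‖ ≤ D^i` for `i ≥ 1` as soon as these two numbers are `≤ D`, `≤ D²`. -/
theorem norm_iteratedFDeriv_bilinSelf_le {X E : Type*} [NormedAddCommGroup X] [NormedSpace ℝ X]
    [NormedAddCommGroup E] [NormedSpace ℝ E] (B : E →L[ℝ] E →L[ℝ] ℝ) (hB : ‖B‖ ≤ 1)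
    (L : X →L[ℝ] E) (d : ℝ) {D : ℝ} (hD : 0 ≤ D) {x : X} (h1 : 2 * ‖L‖ * ‖L x‖ ≤ D)
    (h2 : 2 * ‖L‖ ^ 2 ≤ D ^ 2) {i : ℕ} (hi : 1 ≤ i) :
    ‖iteratedFDeriv ℝ i (fun y => B (L y) (L y) + d) x‖ ≤ D ^ i := by
  have hL2 : ∀ m, 2 ≤ m → ‖iteratedFDeriv ℝ m (L : X → E) x‖ = 0 := by
    intro m hm
    obtain ⟨j, rfl⟩ : ∃ j, m = j + 1 + 1 := ⟨m - 2, by omega⟩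
    rw [← norm_iteratedFDeriv_fderiv]
    have : fderiv ℝ (L : X → E) = fun _ => L := funext fun _ => L.fderiv
    rw [this, iteratedFDeriv_succ_const, Pi.zero_apply, norm_zero]
  have hBL : ContDiff ℝ i (fun y => B (L y) (L y)) := by fun_prop
  rw [fun_iteratedFDeriv_add_apply hBL.contDiffAt contDiffAt_const,
    iteratedFDeriv_const_of_ne (by omega), Pi.zero_apply, add_zero]
  refine (B.norm_iteratedFDeriv_le_of_bilinear_of_le_one L.contDiff L.contDiff x le_rfl hB).trans ?_
  have h0 : ‖iteratedFDeriv ℝ 0 (L : X → E) x‖ = ‖L x‖ := norm_iteratedFDeriv_zero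
  have h1' : ‖iteratedFDeriv ℝ 1 (L : X → E) x‖ = ‖L‖ := by
    rw [norm_iteratedFDeriv_one, L.fderiv]
  obtain ⟨i, rfl⟩ : ∃ j, i = j + 1 := ⟨i - 1, by omega⟩
  rcases i with _ | _ | i
  · simp only [zero_add, Finset.sum_range_succ, Finset.sum_range_zero, Nat.choose_zero_right,
      Nat.cast_one, Nat.sub_zero, h0, h1', one_mul, Nat.choose_self, pow_one]
    linarith
  · simp only [zero_add, Nat.reduceAdd, Finset.sum_range_succ, Finset.sum_range_zero,
      Nat.choose_zero_right, Nat.cast_one, Nat.sub_zero, hL2 2 le_rfl, mul_zero, zero_add,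
      Nat.choose_one_right, Nat.cast_ofNat, Nat.add_one_sub_one, h1', Nat.choose_self, h0,
      zero_mul, add_zero]
    nlinarith
  · rw [Finset.sum_eq_zero]
    · exact pow_nonneg hD _
    intro k _
    by_cases hk2 : 2 ≤ k
    · rw [hL2 k hk2, mul_zero, zero_mul]
    · rw [hL2 (i + 1 + 1 + 1 - k) (by omega), mul_zero]

/-- Single-factor bound: composing a Gevrey-2 profile `g` (`‖g^{(l)}‖ ≤ Cg^(l+1) (l!)²`, `Cg ≥ 1`) with a
smooth map `q` whose derivatives of order `1 ≤ i ≤ l` at `x` are `≤ D^i` gives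
`‖D^l (g ∘ q) x‖ ≤ Cg (Cg D)^l (l!)³` (`norm_iteratedFDeriv_comp_le`). -/
theorem norm_iteratedFDeriv_gevreyComp_le {X : Type*} [NormedAddCommGroup X] [NormedSpace ℝ X]
    {g : ℝ → ℝ} {Cg D : ℝ} (hCg : 1 ≤ Cg) (hg : ContDiff ℝ ∞ g)
    (hgD : ∀ (l : ℕ) (x : ℝ), ‖iteratedDeriv l g x‖ ≤ Cg ^ (l + 1) * ((l.factorial : ℝ)) ^ 2)
    {q : X → ℝ} (hq : ContDiff ℝ ∞ q) {l : ℕ} {x : X}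
    (hDq : ∀ i, 1 ≤ i → i ≤ l → ‖iteratedFDeriv ℝ i q x‖ ≤ D ^ i) :
    ‖iteratedFDeriv ℝ l (fun y => g (q y)) x‖ ≤ Cg * (Cg * D) ^ l * ((l.factorial : ℝ)) ^ 3 := by
  have hC : ∀ i, i ≤ l → ‖iteratedFDeriv ℝ i g (q x)‖ ≤ Cg ^ (l + 1) * ((l.factorial : ℝ)) ^ 2 := by
    intro i hi
    rw [norm_iteratedFDeriv_eq_norm_iteratedDeriv]
    calc ‖iteratedDeriv i g (q x)‖ ≤ Cg ^ (i + 1) * ((i.factorial : ℝ)) ^ 2 := hgD i _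
      _ ≤ Cg ^ (l + 1) * ((l.factorial : ℝ)) ^ 2 := by
        gcongr
  have := norm_iteratedFDeriv_comp_le hg hq (mod_cast le_top) x hC hDq
  calc ‖iteratedFDeriv ℝ l (fun y => g (q y)) x‖ = ‖iteratedFDeriv ℝ l (g ∘ q) x‖ := rfl
    _ ≤ l ! * (Cg ^ (l + 1) * ((l.factorial : ℝ)) ^ 2) * D ^ l := this
    _ = Cg * (Cg * D) ^ l * ((l.factorial : ℝ)) ^ 3 := by ring

/-- **Registered stub `gevreyPairCutoffFamily`** (line `Sketch`, Z1-explicit E2). From a Gevrey-2 step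
profile `g` (smooth, `[0,1]`-valued, `0` on `(-∞,0]`, `1` on `[1,∞)`, `‖g^{(l)}‖ ≤ Cg^(l+1) (l!)²`) one gets
a constant `A = 8 Cg²` such that for all `n` and `κ ≥ 1` there is a smooth `[0,1]`-valued cutoff `ψ` on
`Fin n → ℝ⁴`, equal to `1` where all pairwise distances are `≥ 2/κ`, to `0` where some pairwise distance is
`≤ 1/κ`, with `‖D^l ψ x‖ ≤ (A (n+1)² κ)^l (l!)³`.  Here `ψ = ∏_{i ≠ j} g (κ²‖xᵢ - xⱼ‖² - 1)`. -/
theorem gevreyPairCutoffFamily : ∀ (g : ℝ → ℝ) (Cg : ℝ), 1 ≤ Cg → ContDiff ℝ ∞ g → (∀ x, 0 ≤ g x ∧ g x ≤ 1) → (∀ x ≤ 0, g x = 0) → (∀ x, 1 ≤ x → g x = 1) → (∀ (l : ℕ) (x : ℝ), ‖iteratedDeriv l g x‖ ≤ Cg ^ (l + 1) * ((l.factorial : ℝ)) ^ 2) → ∃ A : ℝ, 1 ≤ A ∧ ∀ (n : ℕ) (κ : ℝ), 1 ≤ κ → ∃ ψ : (Fin n → EuclideanSpace ℝ (Fin 4))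 → ℝ, ContDiff ℝ ∞ ψ ∧ (∀ x, 0 ≤ ψ x ∧ ψ x ≤ 1) ∧ (∀ x, (∀ i j, i ≠ j → 2 / κ ≤ ‖x i - x j‖) → ψ x = 1) ∧ (∀ x, (∃ i j, i ≠ j ∧ ‖x i - x j‖ ≤ 1 / κ) → ψ x = 0) ∧ ∀ (l : ℕ) (x : Fin n → EuclideanSpace ℝ (Fin 4)), ‖iteratedFDeriv ℝ l ψ x‖ ≤ (A * ((n : ℝ) + 1) ^ 2 * κ) ^ l * ((l.factorial : ℝ)) ^ 3 := by
  intro g Cg hCg hg h01 h0 h1 hgD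
  refine ⟨8 * Cg ^ 2, by nlinarith, ?_⟩
  intro n κ hκ
  have hκ0 : 0 < κ := one_pos.trans_le hκ
  have hκne : κ ≠ 0 := hκ0.ne'
  -- the bilinear form `B v w = ⟪v, w⟫` on `ℝ⁴`
  obtain ⟨B, hB, hBapply⟩ : ∃ B : EuclideanSpace ℝ (Fin 4) →L[ℝ] EuclideanSpace ℝ (Fin 4) →L[ℝ] ℝ,
      ‖B‖ ≤ 1 ∧ ∀ v, B v v = ‖v‖ ^ 2 :=
    ⟨innerSL ℝ, norm_innerSL_le ℝ, fun v => real_inner_self_eq_norm_sq v⟩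
  -- the scaled difference maps `L p y = κ • (y p.1 - y p.2)`
  obtain ⟨L, hL⟩ : ∃ L : Fin n × Fin n →
      ((Fin n → EuclideanSpace ℝ (Fin 4)) →L[ℝ] EuclideanSpace ℝ (Fin 4)),
      ∀ p y, L p y = κ • (y p.1 - y p.2) :=
    ⟨fun p => κ • ((ContinuousLinearMap.proj p.1 :
        (Fin n → EuclideanSpace ℝ (Fin 4)) →L[ℝ] EuclideanSpace ℝ (Fin 4)) -
      (ContinuousLinearMap.proj p.2 : (Fin n → EuclideanSpace ℝ (Fin 4)) →L[ℝ] EuclideanSpace ℝ (Fin 4))),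
      fun p y => rfl⟩
  have hLn : ∀ p y, ‖L p y‖ = κ * ‖y p.1 - y p.2‖ := fun p y => by
    rw [hL, norm_smul, Real.norm_of_nonneg hκ0.le]
  have hLnorm : ∀ p, ‖L p‖ ≤ 2 * κ := fun p => by
    refine ContinuousLinearMap.opNorm_le_bound _ (by positivity) fun y => ?_
    rw [hLn]
    calc κ * ‖y p.1 - y p.2‖ ≤ κ * (‖y p.1‖ + ‖y p.2‖) := by gcongr; exact norm_sub_le _ _
      _ ≤ κ * (‖y‖ + ‖y‖) := by gcongr <;> exact norm_le_pi_norm y _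
      _ = 2 * κ * ‖y‖ := by ring
  -- the inner maps `q p y = κ² ‖y p.1 - y p.2‖² - 1`
  obtain ⟨q, hq⟩ : ∃ q : Fin n × Fin n → (Fin n → EuclideanSpace ℝ (Fin 4)) → ℝ,
      ∀ p, q p = fun y => B (L p y) (L p y) + -1 := ⟨_, fun p => rfl⟩
  have hqs : ∀ p, ContDiff ℝ ∞ (q p) := fun p => by rw [hq p]; fun_prop
  have hgs : ∀ p, ContDiff ℝ ∞ (fun y => g (q p y)) := fun p => hg.comp (hqs p)
  have hqv : ∀ p y, q p y = ‖L p y‖ ^ 2 + -1 := fun p y => by simp only [hq, hBapply]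
  have hq1 : ∀ p y, 2 ≤ ‖L p y‖ → 1 ≤ q p y := fun p y h => by
    rw [hqv]; nlinarith [mul_le_mul h h (by norm_num) (norm_nonneg _)]
  have hq0 : ∀ p y, ‖L p y‖ ≤ 1 → q p y ≤ 0 := fun p y h => by
    rw [hqv]; nlinarith [mul_le_mul h h (norm_nonneg _) zero_le_one]
  -- single-factor Gevrey-3 bound
  have hfac : ∀ p l x, ‖iteratedFDeriv ℝ l (fun y => g (q p y)) x‖ ≤
      (8 * Cg ^ 2 * κ) ^ l * ((l.factorial : ℝ)) ^ 3 := by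
    intro p l x
    rcases Nat.eq_zero_or_pos l with rfl | hl
    · rw [norm_iteratedFDeriv_zero, Real.norm_of_nonneg (h01 _).1]
      simpa using (h01 _).2
    rcases le_or_gt ‖L p x‖ 2 with hx | hx
    · have hDq : ∀ i, 1 ≤ i → i ≤ l → ‖iteratedFDeriv ℝ i (q p) x‖ ≤ (8 * κ) ^ i := by
        intro i hi _
        rw [hq p]
        refine norm_iteratedFDeriv_bilinSelf_le B hB (L p) _ (by positivity) ?_ ?_ hi
        · calc 2 * ‖L p‖ * ‖L p x‖ ≤ 2 * (2 * κ) * 2 := by gcongr; exact hLnorm p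
            _ = 8 * κ := by ring
        · calc 2 * ‖L p‖ ^ 2 ≤ 2 * (2 * κ) ^ 2 := by gcongr; exact hLnorm p
            _ ≤ (8 * κ) ^ 2 := by nlinarith [sq_nonneg κ]
      refine (norm_iteratedFDeriv_gevreyComp_le hCg hg hgD (hqs p) hDq).trans ?_
      have key : Cg * (Cg * (8 * κ)) ^ l ≤ (8 * Cg ^ 2 * κ) ^ l :=
        calc Cg * (Cg * (8 * κ)) ^ l ≤ Cg ^ l * (Cg * (8 * κ)) ^ l := by
              gcongr; exact le_self_pow₀ hCg hl.ne'
          _ = (8 * Cg ^ 2 * κ) ^ l := by rw [← mul_pow]; ring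
      exact mul_le_mul_of_nonneg_right key (by positivity)
    · have hev : (fun y => g (q p y)) =ᶠ[𝓝 x] fun _ => (1 : ℝ) := by
        filter_upwards [(isOpen_lt continuous_const (L p).continuous.norm).mem_nhds hx] with y hy
        exact h1 _ (hq1 p y (le_of_lt hy))
      rw [(hev.iteratedFDeriv ℝ l).eq_of_nhds, iteratedFDeriv_const_of_ne hl.ne', Pi.zero_apply,
        norm_zero]
      positivity
  -- Leibniz induction over finite sets of pairs
  have hprod : ∀ T : Finset (Fin n × Fin n), ∀ l x,
      ‖iteratedFDeriv ℝ l (fun y => ∏ p ∈ T, g (q p y)) x‖ ≤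
        (((T.card : ℝ) + 1) * (8 * Cg ^ 2 * κ)) ^ l * ((l.factorial : ℝ)) ^ 3 := by
    intro T
    induction T using Finset.induction_on with
    | empty =>
      intro l x
      simp only [Finset.prod_empty, Finset.card_empty, Nat.cast_zero, zero_add, one_mul]
      rcases l with _ | l
      · rw [norm_iteratedFDeriv_zero]; simp
      · rw [iteratedFDeriv_succ_const, Pi.zero_apply, norm_zero]; positivity
    | insert p T hp ih =>
      intro l x
      simp only [Finset.prod_insert hp]
      refine (norm_iteratedFDeriv_mul_le (n := l) (hgs p) (contDiff_prod (t := T) fun p _ => hgs p) x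
        (mod_cast le_top)).trans ?_
      refine (sum_choose_mul_gevrey_le (a := 8 * Cg ^ 2 * κ) (b := ((T.card : ℝ) + 1) * (8 * Cg ^ 2 * κ))
        (by positivity) (by positivity) (u := fun i => ‖iteratedFDeriv ℝ i (fun y => g (q p y)) x‖)
        (v := fun i => ‖iteratedFDeriv ℝ i (fun y => ∏ p ∈ T, g (q p y)) x‖) (fun i => norm_nonneg _)
        (fun i => hfac p i x) (fun i => ih i x) l).trans (le_of_eq ?_)
      rw [Finset.card_insert_of_notMem hp]; push_cast; ring
  -- the set of off-diagonal ordered pairs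
  obtain ⟨S, hSmem, hScard⟩ : ∃ S : Finset (Fin n × Fin n), (∀ p, p ∈ S ↔ p.1 ≠ p.2) ∧ S.card ≤ n * n :=
    ⟨Finset.univ.filter fun p => p.1 ≠ p.2, fun p => by simp,
      (Finset.card_filter_le _ _).trans (by simp)⟩
  refine ⟨fun y => ∏ p ∈ S, g (q p y), contDiff_prod fun p _ => hgs p,
    fun x => ⟨Finset.prod_nonneg fun p _ => (h01 _).1,
      Finset.prod_le_one (fun p _ => (h01 _).1) fun p _ => (h01 _).2⟩, ?_, ?_, ?_⟩
  · intro x hx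
    refine Finset.prod_eq_one fun p hp => h1 _ (hq1 p x ?_)
    rw [hLn]
    calc (2 : ℝ) = κ * (2 / κ) := by field_simp
      _ ≤ κ * ‖x p.1 - x p.2‖ := by gcongr; exact hx _ _ ((hSmem p).mp hp)
  · rintro x ⟨i, j, hij, hle⟩
    refine Finset.prod_eq_zero ((hSmem (i, j)).mpr hij) (h0 _ (hq0 _ x ?_))
    rw [hLn]
    calc κ * ‖x i - x j‖ ≤ κ * (1 / κ) := by gcongr
      _ = 1 := by field_simp
  · intro l x
    refine (hprod S l x).trans ?_
    have hc : (S.card : ℝ) + 1 ≤ ((n : ℝ) + 1) ^ 2 := by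
      have : (S.card : ℝ) ≤ (n : ℝ) * n := by exact_mod_cast hScard
      nlinarith [this, (Nat.cast_nonneg n : (0 : ℝ) ≤ n)]
    have hbase : ((S.card : ℝ) + 1) * (8 * Cg ^ 2 * κ) ≤ 8 * Cg ^ 2 * ((n : ℝ) + 1) ^ 2 * κ :=
      calc ((S.card : ℝ) + 1) * (8 * Cg ^ 2 * κ) ≤ ((n : ℝ) + 1) ^ 2 * (8 * Cg ^ 2 * κ) := by gcongr
        _ = 8 * Cg ^ 2 * ((n : ℝ) + 1) ^ 2 * κ := by ring
    exact mul_le_mul_of_nonneg_right (pow_le_pow_left₀ (by positivity) hbase l) (by positivity)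

end Summit.QuantumFields.YangMills.Cruxes.HypercubicLimit.CouplingResponse

end
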